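import Summits.AtomisticToContinuum.Crystallization.Theorems.FrustratedLawDichotomyTwoShellRigidityCells
import Summits.AtomisticToContinuum.Crystallization.Theorems.FrustratedLawDichotomyTwoShellRigidityFrames

/-!
# FrustratedLawDichotomy · the cell lemma `TetraCellAt` of R (coarse capped rigidity) — PROVED, both patterns, `c = 11`

Beneath the landed cut `KR2_shape ⟸ G ∧ P ∧ M` (`FrustratedLawDichotomyTwoShellRigidityCut`, p820342) and the split of
`R = CoarseCappedRigidity K θ` into `Extraction ∧ TetraCell ∧ OctaCell ∧ FrameAssembly` with proved glue
(`FrustratedLawDichotomyTwoShellRigidityCells.coarseCappedRigidityAt_of_cells`; `Extraction θ` proved in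
`FrustratedLawDichotomyTwoShellRigidityExtraction`, p820807), this file PROVES the cell lemma `TetraCellAt c Pat` for BOTH kissing
patterns with the explicit constant `c = 11` (and hence every `c ≥ 11`, `tetraCellAt_mono`):

* centre `0` + a link triangle `u, w, x` (pattern contacts — unit vectors at mutual distance `1`) and data `p u, p w, p x` with radii
  in `[d, (1+θ)d]` and mutual distances in `[d/(1+θ), (1+θ)²d]`, `0 < θ ≤ 1/100` ⟹ ONE linear isometry `A` with
  `‖p z − d·A z‖ ≤ 11·θ·d` (`tetra_fit`, `tetraCellAt_fcc`, `tetraCellAt_hcp`, `cellLemmas_tetra`).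

Method (elementary, certificate-free): expand the reference triple and the (normalised) data triple in their Gram–Schmidt frames
(`FrustratedLawDichotomyTwoShellRigidityFrames.gramSchmidt_triple`), match the frames by a linear isometry
(`exists_linearIsometry_of_frames`), read the Gram data off the distances (reference: `β₀ = δ₀ = 1/2`, `γ₀² = 3/4`, `γ₀ε₀ = 1/4`,
`ζ₀² = 2/3`; data: windows of width `O(θ)`) and compare coefficients (`tetra_coeff_bounds`).  The constant is not optimal
(first-order optimum `c_T ≈ 2.09`, lens-5 g30 `cells.py`); what `R` needs is one explicit `c`.  No `sorry`, no defs.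
-/

noncomputable section

namespace Summit.AtomisticToContinuum.Crystallization.Theorems.FrustratedLawDichotomyTwoShellRigidityTetraCell

open Literature.Geometry.DiscreteGeometry
open Summit.AtomisticToContinuum.Crystallization.Theorems.FrustratedLawDichotomyTwoShellRigidityCut (E3)
open Summit.AtomisticToContinuum.Crystallization.Theorems.FrustratedLawDichotomyTwoShellRigidityCells
open Summit.AtomisticToContinuum.Crystallization.Theorems.FrustratedLawDichotomyTwoShellRigidityFrames
open scoped RealInnerProductSpace

/-! ## The near-regular tetrahedron with apex `0` -/

/-- Unit vectors at distance `1` have inner product `1/2`. [folklore] -/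
theorem inner_eq_half_of_unit {u w : E3} (hu : ‖u‖ = 1) (hw : ‖w‖ = 1) (h : dist u w = 1) : ⟪u, w⟫ = 1 / 2 := by
  have h1 : ‖u - w‖ ^ 2 = ‖u‖ ^ 2 - 2 * ⟪u, w⟫ + ‖w‖ ^ 2 := norm_sub_sq_real u w
  rw [← dist_eq_norm, h, hu, hw] at h1
  linarith

/-- Polarisation: `⟪a, b⟫ = (‖a‖² + ‖b‖² − dist(a,b)²)/2`. [folklore] -/
theorem inner_eq_of_dist (a b : E3) : ⟪a, b⟫ = (‖a‖ ^ 2 + ‖b‖ ^ 2 - dist a b ^ 2) / 2 := by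
  have h1 : ‖a - b‖ ^ 2 = ‖a‖ ^ 2 - 2 * ⟪a, b⟫ + ‖b‖ ^ 2 := norm_sub_sq_real a b
  rw [← dist_eq_norm] at h1
  linarith

/-- **Near-regular tetrahedron, normalised.**  `u, w, x` unit vectors with mutual distances `1`; `a, b, c` with norms in `[1, 1+t]`
and mutual distances in `[1/(1+t), (1+t)²]`, `0 < t ≤ 1/100` ⟹ a linear isometry `A` with `‖a − A u‖, ‖b − A w‖, ‖c − A x‖ ≤ 11·t`.
[folklore] -/
theorem tetra_fit_unit {u w x a b c : E3} (hu : ‖u‖ = 1) (hw : ‖w‖ = 1) (hx : ‖x‖ = 1) (huw : dist u w = 1)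
    (hwx : dist w x = 1) (hux : dist u x = 1) {t : ℝ} (ht0 : 0 < t) (ht1 : t ≤ 1 / 100)
    (ha1 : 1 ≤ ‖a‖) (ha2 : ‖a‖ ≤ 1 + t) (hb1 : 1 ≤ ‖b‖) (hb2 : ‖b‖ ≤ 1 + t) (hc1 : 1 ≤ ‖c‖) (hc2 : ‖c‖ ≤ 1 + t)
    (hab1 : 1 / (1 + t) ≤ dist a b) (hab2 : dist a b ≤ (1 + t) ^ 2) (hac1 : 1 / (1 + t) ≤ dist a c)
    (hac2 : dist a c ≤ (1 + t) ^ 2) (hbc1 : 1 / (1 + t) ≤ dist b c) (hbc2 : dist b c ≤ (1 + t) ^ 2) :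
    ∃ A : E3 →ₗᵢ[ℝ] E3, ‖a - A u‖ ≤ 11 * t ∧ ‖b - A w‖ ≤ 11 * t ∧ ‖c - A x‖ ≤ 11 * t := by
  obtain ⟨e₀, e₁, e₂, β₀, γ₀, δ₀, ε₀, ζ₀, he0, he1, he2, he01, he02, he12, hu', hw', hx', hγ₀, hζ₀⟩ :=
    gramSchmidt_triple (finrank_euclideanSpace_fin : Module.finrank ℝ E3 = 3) u w x
  obtain ⟨f₀, f₁, f₂, β, γ, δ, ε, ζ, hf0, hf1, hf2, hf01, hf02, hf12, ha', hb', hc', hγ, hζ⟩ :=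
    gramSchmidt_triple (finrank_euclideanSpace_fin : Module.finrank ℝ E3 = 3) a b c
  obtain ⟨A, hA0, hA1, hA2⟩ := exists_linearIsometry_of_frames (finrank_euclideanSpace_fin : Module.finrank ℝ E3 = 3) he0 he1 he2 he01 he02 he12 hf0 hf1 hf2 hf01 hf02 hf12
  have hE := inner_frame he0 he1 he2 he01 he02 he12
  have hEn := norm_sq_frame he0 he1 he2 he01 he02 he12
  have hF := inner_frame hf0 hf1 hf2 hf01 hf02 hf12
  have hFn := norm_sq_frame hf0 hf1 hf2 hf01 hf02 hf12
  -- expansions with all three coefficients displayed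
  have hu3 : u = (1 : ℝ) • e₀ + (0 : ℝ) • e₁ + (0 : ℝ) • e₂ := by rw [hu', hu]; module
  have hw3 : w = β₀ • e₀ + γ₀ • e₁ + (0 : ℝ) • e₂ := by rw [hw']; module
  have ha3 : a = ‖a‖ • f₀ + (0 : ℝ) • f₁ + (0 : ℝ) • f₂ := by rw [← ha']; module
  have hb3 : b = β • f₀ + γ • f₁ + (0 : ℝ) • f₂ := by rw [hb']; module
  -- reference Gram data (exact)
  have r1 : β₀ = 1 / 2 := by
    have h := inner_eq_half_of_unit hu hw huw
    rw [hu3, hw3, hE] at h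
    linarith only [h]
  have r2 : γ₀ ^ 2 = 3 / 4 := by
    have h := hEn β₀ γ₀ 0
    rw [← hw3, hw, r1] at h
    linarith only [h]
  have r3 : δ₀ = 1 / 2 := by
    have h := inner_eq_half_of_unit hu hx hux
    rw [hu3, hx', hE] at h
    linarith only [h]
  have r4 : γ₀ * ε₀ = 1 / 4 := by
    have h := inner_eq_half_of_unit hw hx hwx
    rw [hw3, hx', hE, r1, r3] at h
    linarith only [h]
  have r5 : ζ₀ ^ 2 = 2 / 3 := by
    have h := hEn δ₀ ε₀ ζ₀
    rw [← hx', hx, r3] at h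
    have h' : γ₀ ^ 2 * ε₀ ^ 2 = 1 / 16 := by rw [← mul_pow, r4]; norm_num
    rw [r2] at h'
    linarith only [h, h']
  -- data Gram relations
  have d1 : ‖a‖ * β = (‖a‖ ^ 2 + ‖b‖ ^ 2 - dist a b ^ 2) / 2 := by
    have h := inner_eq_of_dist a b
    rw [ha3, hb3, hF] at h
    rw [← ha3, ← hb3] at h
    linarith only [h]
  have d2 : ‖b‖ ^ 2 = β ^ 2 + γ ^ 2 := by
    have h := hFn β γ 0
    rw [← hb3] at h
    linarith only [h]
  have d3 : ‖a‖ * δ = (‖a‖ ^ 2 + ‖c‖ ^ 2 - dist a c ^ 2) / 2 := by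
    have h := inner_eq_of_dist a c
    rw [ha3, hc', hF] at h
    rw [← ha3, ← hc'] at h
    linarith only [h]
  have d4 : β * δ + γ * ε = (‖b‖ ^ 2 + ‖c‖ ^ 2 - dist b c ^ 2) / 2 := by
    have h := inner_eq_of_dist b c
    rw [hb3, hc', hF] at h
    rw [← hb3, ← hc'] at h
    linarith only [h]
  have d5 : ‖c‖ ^ 2 = δ ^ 2 + ε ^ 2 + ζ ^ 2 := by
    have h := hFn δ ε ζ
    rw [← hc'] at h
    exact h
  obtain ⟨B1, B2, B3⟩ := tetra_coeff_bounds ht0 ht1 ha1 ha2 hb1 hb2 hc1 hc2 hab1 hab2 hac1 hac2 hbc1 hbc2 d1 hγ d2 d3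
    d4 hζ d5 hγ₀ r2 r4 hζ₀ r5
  -- the three error vectors in the data frame
  have hAu : A u = f₀ := by rw [hu', hu, one_smul, hA0]
  have v1 : a - A u = (‖a‖ - 1) • f₀ + (0 : ℝ) • f₁ + (0 : ℝ) • f₂ := by
    rw [hAu, sub_smul, one_smul, zero_smul, zero_smul, add_zero, add_zero, ← ha']
  have v2 : b - A w = (β - 1 / 2) • f₀ + (γ - γ₀) • f₁ + (0 : ℝ) • f₂ := by
    rw [hw3, map_add, map_add, map_smul, map_smul, map_smul, hA0, hA1, hA2, hb3, r1]; module
  have v3 : c - A x = (δ - 1 / 2) • f₀ + (ε - ε₀) • f₁ + (ζ - ζ₀) • f₂ := by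
    rw [hx', map_add, map_add, map_smul, map_smul, map_smul, hA0, hA1, hA2, hc', r3]; module
  have h11 : (0 : ℝ) ≤ 11 * t := by positivity
  refine ⟨A, ?_, ?_, ?_⟩
  · rw [v1]; exact norm_frame_le hf0 hf1 hf2 hf01 hf02 hf12 h11 B1
  · rw [v2]; exact norm_frame_le hf0 hf1 hf2 hf01 hf02 hf12 h11 B2
  · rw [v3]; exact norm_frame_le hf0 hf1 hf2 hf01 hf02 hf12 h11 B3

/-- **Near-regular tetrahedron at scale `d`.**  Unit reference triangle `u, w, x` (mutual distances `1`); data `a, b, c` with radii in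
`[d, (1+θ)d]` and mutual distances in `[d/(1+θ), (1+θ)²d]`, `0 < θ ≤ 1/100`, `0 < d` ⟹ a linear isometry `A` with
`‖a − d·A u‖, ‖b − d·A w‖, ‖c − d·A x‖ ≤ 11·θ·d`. [folklore] -/
theorem tetra_fit {u w x : E3} (hu : ‖u‖ = 1) (hw : ‖w‖ = 1) (hx : ‖x‖ = 1) (huw : dist u w = 1) (hwx : dist w x = 1)
    (hux : dist u x = 1) {θ d : ℝ} (hθ0 : 0 < θ) (hθ1 : θ ≤ 1 / 100) (hd : 0 < d) {a b c : E3}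
    (ha1 : d ≤ ‖a‖) (ha2 : ‖a‖ ≤ (1 + θ) * d) (hb1 : d ≤ ‖b‖) (hb2 : ‖b‖ ≤ (1 + θ) * d) (hc1 : d ≤ ‖c‖)
    (hc2 : ‖c‖ ≤ (1 + θ) * d) (hab1 : d / (1 + θ) ≤ dist a b) (hab2 : dist a b ≤ (1 + θ) ^ 2 * d)
    (hac1 : d / (1 + θ) ≤ dist a c) (hac2 : dist a c ≤ (1 + θ) ^ 2 * d) (hbc1 : d / (1 + θ) ≤ dist b c)
    (hbc2 : dist b c ≤ (1 + θ) ^ 2 * d) :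
    ∃ A : E3 →ₗᵢ[ℝ] E3, ‖a - d • A u‖ ≤ 11 * θ * d ∧ ‖b - d • A w‖ ≤ 11 * θ * d ∧ ‖c - d • A x‖ ≤ 11 * θ * d := by
  have hd' : d ≠ 0 := hd.ne'
  have h1θ : 0 < 1 + θ := by linarith
  have hnd : ‖d⁻¹‖ = d⁻¹ := by rw [Real.norm_eq_abs, abs_of_pos (inv_pos.2 hd)]
  -- normalised data
  have hnorm : ∀ {v : E3}, d ≤ ‖v‖ → ‖v‖ ≤ (1 + θ) * d → 1 ≤ ‖d⁻¹ • v‖ ∧ ‖d⁻¹ • v‖ ≤ 1 + θ := by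
    intro v h1 h2
    rw [norm_smul, hnd, inv_mul_eq_div]
    exact ⟨(one_le_div hd).2 h1, (div_le_iff₀ hd).2 h2⟩
  have hdist : ∀ {v v' : E3}, d / (1 + θ) ≤ dist v v' → dist v v' ≤ (1 + θ) ^ 2 * d →
      1 / (1 + θ) ≤ dist (d⁻¹ • v) (d⁻¹ • v') ∧ dist (d⁻¹ • v) (d⁻¹ • v') ≤ (1 + θ) ^ 2 := by
    intro v v' h1 h2
    rw [dist_smul₀, hnd, inv_mul_eq_div]
    refine ⟨(le_div_iff₀ hd).2 ?_, (div_le_iff₀ hd).2 h2⟩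
    rw [div_mul_eq_mul_div, one_mul]
    exact h1
  obtain ⟨ha1', ha2'⟩ := hnorm ha1 ha2
  obtain ⟨hb1', hb2'⟩ := hnorm hb1 hb2
  obtain ⟨hc1', hc2'⟩ := hnorm hc1 hc2
  obtain ⟨hab1', hab2'⟩ := hdist hab1 hab2
  obtain ⟨hac1', hac2'⟩ := hdist hac1 hac2
  obtain ⟨hbc1', hbc2'⟩ := hdist hbc1 hbc2
  obtain ⟨A, hA, hB, hC⟩ := tetra_fit_unit hu hw hx huw hwx hux hθ0 hθ1 ha1' ha2' hb1' hb2' hc1' hc2' hab1' hab2'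
    hac1' hac2' hbc1' hbc2'
  have hscale : ∀ {v z : E3}, ‖d⁻¹ • v - A z‖ ≤ 11 * θ → ‖v - d • A z‖ ≤ 11 * θ * d := by
    intro v z h
    have hv : v - d • A z = d • (d⁻¹ • v - A z) := by rw [smul_sub, smul_smul, mul_inv_cancel₀ hd', one_smul]
    rw [hv, norm_smul, Real.norm_eq_abs, abs_of_pos hd]
    nlinarith [h, hd]
  exact ⟨A, hscale hA, hscale hB, hscale hC⟩

/-! ## The cell lemma `TetraCellAt 11` for both kissing patterns -/

/-- **`TetraCellAt 11 Pat` for every pattern of unit vectors** (in particular both kissing patterns). [folklore] -/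
theorem tetraCellAt_of_norm_one {Pat : Finset E3} (h1 : ∀ z ∈ Pat, ‖z‖ = 1) : TetraCellAt 11 Pat := by
  intro θ d hθ0 hθ1 hd u w x huw hwx hux p hrad hpair
  have hne : ∀ {z z' : ↥Pat}, dist (z : E3) (z' : E3) = 1 → z ≠ z' := by
    intro z z' h hzz
    rw [hzz, dist_self] at h
    exact zero_ne_one h
  obtain ⟨hu1, hu2⟩ := hrad u (Or.inl rfl)
  obtain ⟨hw1, hw2⟩ := hrad w (Or.inr (Or.inl rfl))
  obtain ⟨hx1, hx2⟩ := hrad x (Or.inr (Or.inr rfl))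
  obtain ⟨huw1, huw2⟩ := hpair u w (Or.inl rfl) (Or.inr (Or.inl rfl)) (hne huw)
  obtain ⟨hux1, hux2⟩ := hpair u x (Or.inl rfl) (Or.inr (Or.inr rfl)) (hne hux)
  obtain ⟨hwx1, hwx2⟩ := hpair w x (Or.inr (Or.inl rfl)) (Or.inr (Or.inr rfl)) (hne hwx)
  obtain ⟨A, hA, hB, hC⟩ := tetra_fit (h1 _ u.2) (h1 _ w.2) (h1 _ x.2) huw hwx hux hθ0 hθ1 hd hu1 hu2 hw1 hw2 hx1 hx2
    huw1 huw2 hux1 hux2 hwx1 hwx2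
  refine ⟨A, ?_⟩
  rintro z (rfl | rfl | rfl)
  exacts [hA, hB, hC]

/-- **`TetraCellAt 11 fccKissingPattern`.** [folklore] -/
theorem tetraCellAt_fcc : TetraCellAt 11 fccKissingPattern :=
  tetraCellAt_of_norm_one fun _ hz => norm_eq_one_of_mem_fccKissingPattern hz

/-- **`TetraCellAt 11 hcpKissingPattern`.** [folklore] -/
theorem tetraCellAt_hcp : TetraCellAt 11 hcpKissingPattern :=
  tetraCellAt_of_norm_one fun _ hz => norm_eq_one_of_mem_hcpKissingPattern hz

/-- Monotonicity of the cell lemma in its constant: `TetraCellAt c Pat → TetraCellAt c' Pat` for `c ≤ c'`. [folklore] -/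
theorem tetraCellAt_mono {c c' : ℝ} {Pat : Finset E3} (hle : c ≤ c') (h : TetraCellAt c Pat) : TetraCellAt c' Pat := by
  intro θ d hθ0 hθ1 hd u w x huw hwx hux p hrad hpair
  obtain ⟨A, hA⟩ := h θ d hθ0 hθ1 hd u w x huw hwx hux p hrad hpair
  refine ⟨A, fun z hz => (hA z hz).trans ?_⟩
  have : 0 ≤ θ * d := by positivity
  nlinarith

/-- **The tetrahedral conjunct of `CellLemmas K c` for every `c ≥ 11`**: `TetraCellAt c fccKissingPattern ∧ TetraCellAt c hcpKissingPattern`.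
(`CellLemmas K c` = this ∧ the octahedral cells ∧ the frame assembly; `coarseCappedRigidity_of_cells`.) [folklore] -/
theorem cellLemmas_tetra {c : ℝ} (hc : 11 ≤ c) :
    TetraCellAt c fccKissingPattern ∧ TetraCellAt c hcpKissingPattern :=
  ⟨tetraCellAt_mono hc tetraCellAt_fcc, tetraCellAt_mono hc tetraCellAt_hcp⟩

end Summit.AtomisticToContinuum.Crystallization.Theorems.FrustratedLawDichotomyTwoShellRigidityTetraCell

end
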